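import Literature.Analysis.FluidPDE.PassiveScalarForcedClass
import Literature.Analysis.FluidPDE.DEIJCriterion
import Literature.Analysis.FunctionSpaces.SpaceTimeWeakCompactness
import Summits.AnomalousDissipation.AnomalousDissipation.Theorems.TwoAndHalfDTwohalfdNegRegularCondensateWeakLimit
import HarnessLib

/-!
# Regular-condensate theorem, block limit: tools

Summit `AnomalousDissipation`, route `TwoAndHalfD`, crux `TwohalfdNeg`
(item stmt-AnomalousDissipation-0211), line `log-kantorovich-enstrophy-transfer`, lead c7
programme "regular-condensate theorem". Support lemmas for the stub `stub_rcLimit` (RC-LIM: the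
weak limit of restarted sourced scalars on a block solves the sourced TRANSPORT equation over the
limit comparison flow), all of them bookkeeping of the DiPerna–Lions passage to the limit in a
linear transport equation (DiPerna–Lions 1989, §II.1; the tree's
`Torus.IsWeakScalarTransportOn.of_tendsto` is the unforced, fixed-viscosity version):

* `rcLimit_isWeakScalarTransportForcedOn_of_le` — restriction of the horizon of a sourced weak
  solution (the forced analogue of `Torus.IsWeakScalarTransportOn.of_le`);
* `rcLimit_eLpNorm_two_le_of_integral_sq_le` — the `L²` norm of a real function from the Bochner
  integral of its square (via `rcWeakLimit_lintegral_enorm_sq_eq` of the neighbouring stub file);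
* `rcLimit_tendsto_eLpNorm_sub_of_eventually_forall_le`, `rcLimit_tendsto_eLpNorm_drift_sub` —
  uniform convergence on `[0,S] × T^d` plus `L²((0,S) × T^d)`-asymptotic drifts give `L²`
  convergence of the drifts to the limit flow;
* `rcLimit_tendsto_integral_mul_inner_of_eLpNorm` — the transport error `∫∫ ϑₖ ⟪wₖ, Φ⟫ → 0` for
  `ϑₖ` bounded in `L²`, `wₖ → 0` in `L²` and `Φ` bounded (Cauchy–Schwarz);
* `rcLimit_tendsto_integral_mul_of_forall_abs_le` — weak convergence against space–time functions
  that are only bounded on `[0,S] × T^d` (clamping in time does not change the pairing);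
* `stub_rcLimitHorizon` — the registered sub-goal of this file (planar horizon restriction, the
  explicit form of the first item).

## References

* R. J. DiPerna, P.-L. Lions, Invent. Math. 98 (1989), §II.1. [`DiPernaLions1989`]
-/

noncomputable section

namespace Summit.AnomalousDissipation.AnomalousDissipation.Theorems.TwohalfdNeg.RegularCondensate

open MeasureTheory Filter Topology Set Function
open scoped ENNReal NNReal InnerProductSpace
open Literature.Analysis.FunctionSpaces Literature.Analysis.FluidPDE

-- the summit and the problem are both called `AnomalousDissipation` (path-aligned namespace)
set_option linter.dupNamespace false

variable {d : Type*} [Fintype d]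

/-! ## Restricting the horizon of a sourced weak solution -/

/-- **Restriction of the horizon (sourced class).** A weak solution of `∂ₜθ + u·∇θ = κΔθ + s` on
`T^d × [0,T)` is a weak solution on `T^d × [0,T₁)` for every `T₁ ≤ T`: test functions for the
shorter horizon are test functions for the longer one, and both the weak integrand and the source
term vanish after their support (forced analogue of `Torus.IsWeakScalarTransportOn.of_le`).
[folklore] -/
theorem rcLimit_isWeakScalarTransportForcedOn_of_le {T κ : ℝ}
    {u : ℝ → UnitAddTorus d → EuclideanSpace ℝ d} {s : ℝ → UnitAddTorus d → ℝ} {θ₀ : UnitAddTorus d → ℝ} {θ : ℝ → UnitAddTorus d → ℝ}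
    (h : Torus.IsWeakScalarTransportForcedOn T κ u s θ₀ θ) {T₁ : ℝ} (hT₁ : T₁ ≤ T) :
    Torus.IsWeakScalarTransportForcedOn T₁ κ u s θ₀ θ where
  aestronglyMeasurable :=
    h.aestronglyMeasurable.mono_measure
      (Measure.restrict_mono (prod_mono (Ioo_subset_Ioo_right hT₁) subset_rfl) le_rfl)
  aestronglyMeasurable_velocity :=
    h.aestronglyMeasurable_velocity.mono_measure
      (Measure.restrict_mono (prod_mono (Ioo_subset_Ioo_right hT₁) subset_rfl) le_rfl)
  aestronglyMeasurable_source :=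
    h.aestronglyMeasurable_source.mono_measure
      (Measure.restrict_mono (prod_mono (Ioo_subset_Ioo_right hT₁) subset_rfl) le_rfl)
  ae_lintegral_sq_le := by
    obtain ⟨C, hC⟩ := h.ae_lintegral_sq_le
    exact ⟨C, ae_restrict_of_ae_restrict_of_subset (Ioo_subset_Ioo_right hT₁) hC⟩
  lintegral_velocity_lt_top :=
    lt_of_le_of_lt (lintegral_mono_set (Ioo_subset_Ioo_right hT₁)) h.lintegral_velocity_lt_top
  lintegral_mul_lt_top :=
    lt_of_le_of_lt (lintegral_mono_set (Ioo_subset_Ioo_right hT₁)) h.lintegral_mul_lt_top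
  lintegral_source_lt_top :=
    lt_of_le_of_lt (lintegral_mono_set (Ioo_subset_Ioo_right hT₁)) h.lintegral_source_lt_top
  ae_isWeaklyDivFree :=
    ae_restrict_of_ae_restrict_of_subset (Ioo_subset_Ioo_right hT₁) h.ae_isWeaklyDivFree
  weak_eq ψ hψ := by
    obtain ⟨T', hT'lt, hT'⟩ := hψ.2
    have hψT : Torus.IsSpaceTimeTest T ψ := ⟨hψ.1, T', hT'lt.trans_le hT₁, hT'⟩
    have key := h.weak_eq ψ hψT
    set I : ℝ → ℝ := fun t => ∫ x, θ t x *
      (Torus.timeDeriv ψ t x + ⟪u t x, Torus.gradient (ψ t) x⟫_ℝ +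
        κ * Torus.laplacian (ψ t) x) with hI
    set J : ℝ → ℝ := fun t => ∫ x, s t x * ψ t x with hJ
    have hI0 : ∀ t, T' < t → I t = 0 := by
      intro t ht
      simp only [hI]
      refine integral_eq_zero_of_ae (Eventually.of_forall fun x => ?_)
      have h1 : Torus.timeDeriv ψ t x = 0 := Torus.DEIJ.timeDeriv_eq_zero_of_forall_eq_zero hT' ht x
      have h2 : ψ t = 0 := hT' t ht.le
      have hl : Torus.liftAt (0 : UnitAddTorus d → ℝ) x = fun _ => 0 := by
        funext v; simp [Torus.liftAt_apply]
      have h3 : Torus.gradient (0 : UnitAddTorus d → ℝ) x = 0 := by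
        rw [Torus.gradient, hl, gradient_fun_const]
      have h4 : Torus.laplacian (0 : UnitAddTorus d → ℝ) x = 0 := by
        rw [Torus.laplacian, hl, InnerProductSpace.laplacian_const]; rfl
      simp [h1, h2, h3, h4]
    have hJ0 : ∀ t, T' < t → J t = 0 := by
      intro t ht
      simp only [hJ]
      refine integral_eq_zero_of_ae (Eventually.of_forall fun x => ?_)
      simp [hT' t ht.le]
    have hmem : ∀ t, t ∈ Ioo 0 T \ Ioo 0 T₁ → T' < t := fun t ht =>
      hT'lt.trans_le (not_lt.1 fun h' => ht.2 ⟨ht.1.1, h'⟩)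
    have hIeq : ∫ t in Ioo 0 T₁, I t = ∫ t in Ioo 0 T, I t :=
      (setIntegral_eq_of_subset_of_forall_sdiff_eq_zero measurableSet_Ioo
        (Ioo_subset_Ioo_right hT₁) fun t ht => hI0 t (hmem t ht)).symm
    have hJeq : ∫ t in Ioo 0 T₁, J t = ∫ t in Ioo 0 T, J t :=
      (setIntegral_eq_of_subset_of_forall_sdiff_eq_zero measurableSet_Ioo
        (Ioo_subset_Ioo_right hT₁) fun t ht => hJ0 t (hmem t ht)).symm
    change (∫ t in Ioo 0 T₁, I t) + (∫ t in Ioo 0 T₁, J t) + ∫ x, θ₀ x * ψ 0 x = 0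
    rw [hIeq, hJeq]
    exact key

/-! ## `L²` bookkeeping -/

omit [Fintype d] in
/-- `‖f‖_{L²} ≤ C^{1/2}` when `∫ f² ≤ C` (real `f` with integrable square). [folklore] -/
theorem rcLimit_eLpNorm_two_le_of_integral_sq_le {α : Type*} [MeasurableSpace α] {μ : Measure α}
    {f : α → ℝ} (hf : Integrable (fun x => f x ^ 2) μ) {C : ℝ} (hC : ∫ x, f x ^ 2 ∂μ ≤ C) :
    eLpNorm f 2 μ ≤ ENNReal.ofReal C ^ (1 / 2 : ℝ) := by
  rw [eLpNorm_two_eq_pow_two_rpow_half, eLpNorm_two_pow_two_eq_lintegral,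
    rcWeakLimit_lintegral_enorm_sq_eq hf]
  exact ENNReal.rpow_le_rpow (ENNReal.ofReal_le_ofReal hC) (by norm_num)

/-! ## Convergence of the drifts in `L²((0,S) × T^d)` -/

/-- Uniform convergence `Wₖ → W'` on `[0,S] × T^d` gives `Wₖ → W'` in `L²((0,S) × T^d)`.
[folklore] -/
theorem rcLimit_tendsto_eLpNorm_sub_of_eventually_forall_le {E : Type*} [NormedAddCommGroup E] {S : ℝ}
    {W : ℕ → ℝ → UnitAddTorus d → E} {W' : ℝ → UnitAddTorus d → E}
    (hunif : ∀ δ : ℝ, 0 < δ → ∀ᶠ k in atTop, ∀ t ∈ Icc 0 S, ∀ x, ‖W k t x - W' t x‖ ≤ δ) :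
    Tendsto (fun k => eLpNorm (fun q : ℝ × UnitAddTorus d => W k q.1 q.2 - W' q.1 q.2) 2
      (((volume : Measure ℝ).restrict (Ioo 0 S)).prod volume)) atTop (𝓝 0) := by
  set μ : Measure (ℝ × UnitAddTorus d) :=
    ((volume : Measure ℝ).restrict (Ioo 0 S)).prod (volume : Measure (UnitAddTorus d)) with hμ
  haveI : IsFiniteMeasure ((volume : Measure ℝ).restrict (Ioo 0 S)) :=
    isFiniteMeasure_restrict.2 measure_Ioo_lt_top.ne
  haveI : IsFiniteMeasure μ := by rw [hμ]; infer_instance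
  set A : ℝ≥0∞ := μ univ ^ (2 : ℝ≥0∞).toReal⁻¹ with hA
  have hAtop : A ≠ ⊤ := ENNReal.rpow_ne_top_of_nonneg (by norm_num) (measure_ne_top μ _)
  have hbd : ∀ δ : ℝ, 0 < δ → ∀ᶠ k in atTop,
      eLpNorm (fun q : ℝ × UnitAddTorus d => W k q.1 q.2 - W' q.1 q.2) 2 μ ≤ A * ENNReal.ofReal δ := by
    intro δ hδ
    filter_upwards [hunif δ hδ] with k hk
    refine eLpNorm_le_of_ae_bound ?_
    filter_upwards [Torus.IsWeakScalarTransportForcedOn.ae_fst_mem_Ioo (d := d) S] with p hp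
    exact hk p.1 (Ioo_subset_Icc_self hp) p.2
  have h1 : Tendsto (fun δ : ℝ => A * ENNReal.ofReal δ) (𝓝 0) (𝓝 0) := by
    have h0 : Tendsto (fun δ : ℝ => ENNReal.ofReal δ) (𝓝 0) (𝓝 0) := by
      simpa using ENNReal.tendsto_ofReal (tendsto_id (x := 𝓝 (0 : ℝ)))
    simpa using ENNReal.Tendsto.const_mul h0 (Or.inr hAtop)
  rw [ENNReal.tendsto_nhds_zero]
  intro ε hε
  obtain ⟨δ, hδε, hδ⟩ : ∃ δ : ℝ, A * ENNReal.ofReal δ ≤ ε ∧ 0 < δ :=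
    (((h1.eventually (eventually_le_nhds hε)).filter_mono nhdsWithin_le_nhds).and
      (self_mem_nhdsWithin (s := Ioi (0 : ℝ)))).exists
  filter_upwards [hbd δ hδ] with k hk
  exact hk.trans hδε

/-- **`L²` convergence of the drifts to the limit flow.** If `vₖ - Wₖ → 0` in
`L²((0,S) × T^d)` (in the `∫⁻ ‖·‖ₑ²` form) and `Wₖ → W'` uniformly on `[0,S] × T^d`, then
`vₖ → W'` in `L²((0,S) × T^d)`. [folklore] -/
theorem rcLimit_tendsto_eLpNorm_drift_sub {E : Type*} [NormedAddCommGroup E] {S : ℝ}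
    {v W : ℕ → ℝ → UnitAddTorus d → E} {W' : ℝ → UnitAddTorus d → E}
    (hvm : ∀ k, AEStronglyMeasurable (uncurry (v k))
      (((volume : Measure ℝ).restrict (Ioo 0 S)).prod volume))
    (hWc : ∀ k, Continuous (uncurry (W k))) (hW'c : Continuous (uncurry W'))
    (hfl : Tendsto (fun k => ∫⁻ p, ‖v k p.1 p.2 - W k p.1 p.2‖ₑ ^ 2
      ∂(((volume : Measure ℝ).restrict (Ioo 0 S)).prod volume)) atTop (𝓝 0))
    (hunif : ∀ δ : ℝ, 0 < δ → ∀ᶠ k in atTop, ∀ t ∈ Icc 0 S, ∀ x, ‖W k t x - W' t x‖ ≤ δ) :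
    Tendsto (fun k => eLpNorm (fun q : ℝ × UnitAddTorus d => v k q.1 q.2 - W' q.1 q.2) 2
      (((volume : Measure ℝ).restrict (Ioo 0 S)).prod volume)) atTop (𝓝 0) := by
  set μ : Measure (ℝ × UnitAddTorus d) :=
    ((volume : Measure ℝ).restrict (Ioo 0 S)).prod (volume : Measure (UnitAddTorus d)) with hμ
  have he1 : Tendsto (fun k => eLpNorm (fun q : ℝ × UnitAddTorus d => v k q.1 q.2 - W k q.1 q.2) 2 μ)
      atTop (𝓝 0) := by
    have h1 : ∀ k, eLpNorm (fun q : ℝ × UnitAddTorus d => v k q.1 q.2 - W k q.1 q.2) 2 μ =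
        (∫⁻ p, ‖v k p.1 p.2 - W k p.1 p.2‖ₑ ^ 2 ∂μ) ^ (1 / 2 : ℝ) := by
      intro k
      rw [eLpNorm_two_eq_pow_two_rpow_half, eLpNorm_two_pow_two_eq_lintegral]
    simp_rw [h1]
    have h2 := ((ENNReal.continuous_rpow_const (y := (1 / 2 : ℝ))).tendsto 0).comp hfl
    rwa [ENNReal.zero_rpow_of_pos (by norm_num : (0 : ℝ) < 1 / 2)] at h2
  have he2 := rcLimit_tendsto_eLpNorm_sub_of_eventually_forall_le (d := d) hunif
  have hsum := he1.add he2
  rw [add_zero] at hsum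
  refine tendsto_of_tendsto_of_tendsto_of_le_of_le tendsto_const_nhds hsum (fun _ => zero_le)
    fun k => ?_
  have e : (fun q : ℝ × UnitAddTorus d => v k q.1 q.2 - W' q.1 q.2) =
      (fun q : ℝ × UnitAddTorus d => v k q.1 q.2 - W k q.1 q.2) +
        fun q : ℝ × UnitAddTorus d => W k q.1 q.2 - W' q.1 q.2 := by
    funext q
    simp only [Pi.add_apply, sub_add_sub_cancel]
  rw [e]
  exact eLpNorm_add_le ((hvm k).sub (hWc k).aestronglyMeasurable)
    ((hWc k).aestronglyMeasurable.sub hW'c.aestronglyMeasurable) one_le_two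

/-! ## The transport error and the clamped weak convergence -/

omit [Fintype d] in
/-- **The transport error tends to zero** (Cauchy–Schwarz): for real `fₖ` bounded in `L²(μ)`,
vector fields `wₖ → 0` in `L²(μ)` and an a.e. bounded field `Φ`, `∫ fₖ ⟪wₖ, Φ⟫ dμ → 0`
(the step "weak × strong convergence of the transport term" of DiPerna–Lions 1989, proof of
Prop. II.1). [cite: DiPernaLions1989, Prop. II.1, proof] -/
theorem rcLimit_tendsto_integral_mul_inner_of_eLpNorm {α : Type*} [MeasurableSpace α] {μ : Measure α}
    {E : Type*} [NormedAddCommGroup E] [InnerProductSpace ℝ E]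
    {f : ℕ → α → ℝ} {w : ℕ → α → E} {Φ : α → E}
    (hfm : ∀ k, AEStronglyMeasurable (f k) μ) {B : ℝ≥0∞} (hB : B ≠ ⊤)
    (hf2 : ∀ k, eLpNorm (f k) 2 μ ≤ B) (hwm : ∀ k, AEStronglyMeasurable (w k) μ)
    (hw : Tendsto (fun k => eLpNorm (w k) 2 μ) atTop (𝓝 0)) {K : ℝ} (hK : ∀ᵐ x ∂μ, ‖Φ x‖ ≤ K) :
    Tendsto (fun k => ∫ x, f k x * ⟪w k x, Φ x⟫_ℝ ∂μ) atTop (𝓝 0) := by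
  have hbound : ∀ k, eLpNorm (w k) 2 μ < ⊤ →
      ‖∫ x, f k x * ⟪w k x, Φ x⟫_ℝ ∂μ‖ ≤ (ENNReal.ofReal |K| * (B * eLpNorm (w k) 2 μ)).toReal := by
    intro k hfin
    have h1 : ‖∫ x, f k x * ⟪w k x, Φ x⟫_ℝ ∂μ‖ ≤ (∫⁻ x, ‖f k x * ⟪w k x, Φ x⟫_ℝ‖ₑ ∂μ).toReal := by
      refine (norm_integral_le_lintegral_norm _).trans_eq ?_
      congr 1
      exact lintegral_congr fun x => ofReal_norm _
    refine h1.trans (ENNReal.toReal_mono (ENNReal.mul_ne_top ENNReal.ofReal_ne_top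
      (ENNReal.mul_ne_top hB hfin.ne)) ?_)
    have h2 : ∫⁻ x, ‖f k x * ⟪w k x, Φ x⟫_ℝ‖ₑ ∂μ ≤
        ∫⁻ x, ENNReal.ofReal |K| * (‖f k x‖ₑ * ‖w k x‖ₑ) ∂μ := by
      refine lintegral_mono_ae ?_
      filter_upwards [hK] with x hx
      have hin : ‖⟪w k x, Φ x⟫_ℝ‖ₑ ≤ ‖w k x‖ₑ * ENNReal.ofReal |K| := by
        rw [← ofReal_norm, ← ofReal_norm, ← ENNReal.ofReal_mul (norm_nonneg _)]
        refine ENNReal.ofReal_le_ofReal ?_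
        exact (norm_inner_le_norm _ _).trans (mul_le_mul_of_nonneg_left
          (hx.trans (le_abs_self _)) (norm_nonneg _))
      rw [enorm_mul]
      calc ‖f k x‖ₑ * ‖⟪w k x, Φ x⟫_ℝ‖ₑ ≤ ‖f k x‖ₑ * (‖w k x‖ₑ * ENNReal.ofReal |K|) := by gcongr
        _ = ENNReal.ofReal |K| * (‖f k x‖ₑ * ‖w k x‖ₑ) := by ring
    refine h2.trans ?_
    rw [lintegral_const_mul' _ _ ENNReal.ofReal_ne_top]
    gcongr
    have h3 := ENNReal.lintegral_mul_le_Lp_mul_Lq μ Real.HolderConjugate.two_two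
      (hfm k).enorm (hwm k).enorm
    calc ∫⁻ x, ‖f k x‖ₑ * ‖w k x‖ₑ ∂μ
        ≤ (∫⁻ x, ‖f k x‖ₑ ^ (2 : ℝ) ∂μ) ^ (1 / (2 : ℝ)) *
          (∫⁻ x, ‖w k x‖ₑ ^ (2 : ℝ) ∂μ) ^ (1 / (2 : ℝ)) := h3
      _ = eLpNorm (f k) 2 μ * eLpNorm (w k) 2 μ := by
          rw [eLpNorm_eq_lintegral_rpow_enorm_toReal two_ne_zero ENNReal.ofNat_ne_top,
            eLpNorm_eq_lintegral_rpow_enorm_toReal two_ne_zero ENNReal.ofNat_ne_top,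
            ENNReal.toReal_ofNat]
      _ ≤ B * eLpNorm (w k) 2 μ := by
          gcongr
          exact hf2 k
  have hlim0 : Tendsto (fun k => (ENNReal.ofReal |K| * (B * eLpNorm (w k) 2 μ)).toReal)
      atTop (𝓝 0) := by
    have h1 := ENNReal.Tendsto.const_mul hw (Or.inr hB) (a := B)
    rw [mul_zero] at h1
    have h2 := ENNReal.Tendsto.const_mul h1 (Or.inr ENNReal.ofReal_ne_top) (a := ENNReal.ofReal |K|)
    rw [mul_zero] at h2
    have h3 := (ENNReal.tendsto_toReal ENNReal.zero_ne_top).comp h2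
    rwa [ENNReal.toReal_zero] at h3
  have hev : ∀ᶠ k in atTop, eLpNorm (w k) 2 μ < ⊤ := (tendsto_order.1 hw).2 ⊤ ENNReal.zero_lt_top
  exact squeeze_zero_norm' (hev.mono fun k hk => hbound k hk) hlim0

/-- **Weak convergence against time-clamped integrands.** If the pairings `∫∫ ϑₖ G` converge to
`∫∫ Θ G` for every bounded measurable `G` on `(0,S) × T^d`, they converge for every measurable
`G` that is bounded on `[0,S] × T^d` only (replace `G` by its clamp to `[0,S]` in time, which
changes nothing on `(0,S) × T^d`). [folklore] -/
theorem rcLimit_tendsto_integral_mul_of_forall_abs_le {S : ℝ} {ϑ : ℕ → ℝ → UnitAddTorus d → ℝ}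
    {Θ : ℝ → UnitAddTorus d → ℝ}
    (hwlim : ∀ G : ℝ × UnitAddTorus d → ℝ,
      AEStronglyMeasurable G (((volume : Measure ℝ).restrict (Ioo 0 S)).prod volume) →
      (∃ M : ℝ, ∀ p, |G p| ≤ M) →
      Tendsto (fun k => ∫ p, ϑ k p.1 p.2 * G p ∂(((volume : Measure ℝ).restrict (Ioo 0 S)).prod volume))
        atTop (𝓝 (∫ p, Θ p.1 p.2 * G p ∂(((volume : Measure ℝ).restrict (Ioo 0 S)).prod volume))))
    {G : ℝ × UnitAddTorus d → ℝ}
    (hG : AEStronglyMeasurable G (((volume : Measure ℝ).restrict (Ioo 0 S)).prod volume))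
    {M : ℝ} (hM : ∀ p : ℝ × UnitAddTorus d, p.1 ∈ Icc 0 S → |G p| ≤ M) :
    Tendsto (fun k => ∫ p, ϑ k p.1 p.2 * G p ∂(((volume : Measure ℝ).restrict (Ioo 0 S)).prod volume))
      atTop (𝓝 (∫ p, Θ p.1 p.2 * G p ∂(((volume : Measure ℝ).restrict (Ioo 0 S)).prod volume))) := by
  set μ : Measure (ℝ × UnitAddTorus d) :=
    ((volume : Measure ℝ).restrict (Ioo 0 S)).prod (volume : Measure (UnitAddTorus d)) with hμ
  set A : Set (ℝ × UnitAddTorus d) := {p | p.1 ∈ Icc 0 S} with hA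
  have hAm : MeasurableSet A := measurable_fst measurableSet_Icc
  have hG' : AEStronglyMeasurable (A.indicator G) μ := hG.indicator hAm
  have hbd : ∃ M' : ℝ, ∀ p, |A.indicator G p| ≤ M' := by
    refine ⟨max M 0, fun p => ?_⟩
    by_cases hp : p ∈ A
    · rw [indicator_of_mem hp]
      exact (hM p hp).trans (le_max_left _ _)
    · rw [indicator_of_notMem hp, abs_zero]
      exact le_max_right _ _
  have hae : ∀ᵐ p ∂μ, A.indicator G p = G p := by
    filter_upwards [Torus.IsWeakScalarTransportForcedOn.ae_fst_mem_Ioo (d := d) S] with p hp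
    exact indicator_of_mem (show p ∈ A from Ioo_subset_Icc_self hp) _
  have e : ∀ f : ℝ → UnitAddTorus d → ℝ,
      ∫ p, f p.1 p.2 * A.indicator G p ∂μ = ∫ p, f p.1 p.2 * G p ∂μ := fun f =>
    integral_congr_ae (by filter_upwards [hae] with p hp; rw [hp])
  have h := hwlim (A.indicator G) hG' hbd
  rw [e Θ] at h
  exact h.congr fun k => e (ϑ k)

/-! ## The registered sub-goal of this tools file -/

/-- **RC-LIM-H `stub_rcLimitHorizon` — restriction of the horizon of a sourced weak scalar
(planar, explicit form).** A weak solution of `∂ₜθ + u·∇θ = κΔθ + s` on `T² × [0,T)` is a weak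
solution on `T² × [0,T₁)` for every `T₁ ≤ T` (`rcLimit_isWeakScalarTransportForcedOn_of_le`);
this is how the restarted level-`k` scalars on `[0, S+1)` are read on the block `[0, S)` in
`stub_rcLimit`. [folklore] -/
theorem stub_rcLimitHorizon :
    ∀ (T T₁ κ : ℝ) (u : ℝ → UnitAddTorus (Fin 2) → EuclideanSpace ℝ (Fin 2))
      (s : ℝ → UnitAddTorus (Fin 2) → ℝ) (θ₀ : UnitAddTorus (Fin 2) → ℝ)
      (θ : ℝ → UnitAddTorus (Fin 2) → ℝ), T₁ ≤ T →
      Torus.IsWeakScalarTransportForcedOn T κ u s θ₀ θ →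
      Torus.IsWeakScalarTransportForcedOn T₁ κ u s θ₀ θ :=
  fun _ _ _ _ _ _ _ hT₁ h => rcLimit_isWeakScalarTransportForcedOn_of_le h hT₁

end Summit.AnomalousDissipation.AnomalousDissipation.Theorems.TwohalfdNeg.RegularCondensate

end
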